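import Literature.AlgebraicGeometry.HodgeTheory.FermatConeSpanCharacterSum
import Literature.AlgebraicGeometry.HodgeTheory.FermatEigenspaceVanishing
import HarnessLib

/-!
# The self-term of the cone criterion is forced by the characters: `π_δ x ≠ 0` from the OFF-stabiliser restriction numbers alone

Family `hodge`, layer `Literature/AlgebraicGeometry/HodgeTheory`. PROOF FILE (theorems only; no
definition, no named fact). Sequel of `FermatConeSpanCharacterSum`
(`fermatProjector_ne_zero_of_twisted_restrictions`: N. Aoki, J. Math. Soc. Japan 39 (1987) Thm. 1-4 (i)
with `r = 0`; Z. Ran, Compositio Math. 42 (1980) Prop. 1.14 — the eigenvalue `-m` of the circulant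
intersection matrix of the `m` cones over one cycle of the sub-Fermat variety `{x_{i₀} = x_{i₁} = 0}`
with vertices on the line `{x_j = 0, j ≠ i₀, i₁}`). That criterion asks for the value of a linear
functional `Λ` on ALL translates `g_a^* x` of the class `x` of the reference cone: `χ_{δ'}(a) t • A`
when `a` moves the vertex (`a_{i₀} ≠ a_{i₁}`: two distinct cones, which meet cleanly along the base —
a transversal intersection number) and `χ_{δ'}(a) s • A` when it does not (`a_{i₀} = a_{i₁}`: the
SELF-intersection of the cone, an excess-intersection number), with `s ≠ t`.

THIS FILE removes the self-term from the hypotheses: **if `x` is a `χ_{δ'}`-eigenvector of the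
stabiliser `{a | a_{i₀} = a_{i₁}}` and `Λ(g_a^* x) = χ_{δ'}(a) t • A` off the stabiliser with
`t ≠ 0`, `A ≠ 0`, then `π_δ x ≠ 0`** (`fermatProjector_ne_zero_of_offStabilizer_restrictions`). The
point: `δ'` — the character `δ` with the two vertex slots zeroed — is a NON-ZERO character with a zero
coordinate, so its eigenspace in the middle cohomology of the even-dimensional Fermat variety
vanishes (`fermatEigenspace_eq_bot_of_apply_eq_zero`, Shioda (1.3)–(1.4): `Hⁿ_prim = ⊕_{α ∈ 𝔄} V(α)`,
all `αᵢ ≢ 0`); hence `π_{δ'} x = 0`, i.e. `Σ_a χ_{δ'}(a)⁻¹ g_a^* x = 0`, i.e.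
`N x = - Σ_{a ∉ Stab} χ_{δ'}(a)⁻¹ g_a^* x` (`N = #Stab`): the reference cone class is minus the
(twisted) sum of the OTHER cones ("`Σ_ε C_ε(D) = X ∩ Join(L, D) ∼ deg(D) h²`, zero on primitive
classes"), and applying `Λ` gives the self-term `N Λ(x) = -(|G| - N) t • A`, that is `s = -(m-1) t`,
automatically different from `t`. For the cone spans of Aoki's Thm. 1-4 (i) (leaf
`Shioda1979_coneSpan_represents_left` of `FermatJuxtapositionSpans`) this leaves only CLEAN
intersections to be computed (two cones with distinct vertices meet exactly along the base), which is
what the tree's `complexGysin_baseChange_of_commonSection` (`GysinCleanBaseChange`) provides.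

* `fermatProjector_eq_zero_of_apply_eq_zero` — `π_{δ'} x = 0` for `δ' ≠ 0` with a zero coordinate
  (middle degree, even dimension);
* `sum_inv_fermatCharacter_smul_map_diagonalMap_eq_zero` — hence `Σ_a χ_{δ'}(a)⁻¹ • g_a^* x = 0`;
* `fermatProjector_ne_zero_of_offStabilizer_restrictions` — **the criterion without self-term**.

## References

* [Aoki1987] N. Aoki, Some new algebraic cycles on Fermat varieties, J. Math. Soc. Japan 39 (1987),
  Thm. 1-4 (i) p. 388, p. 386.
* [Ran1980] Z. Ran, Cycles on Fermat hypersurfaces, Compositio Math. 42 (1980), §1 Prop. 1.7 (i),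
  Prop. 1.14.
* [Shioda1979HodgeFermat] T. Shioda, The Hodge conjecture for Fermat varieties, Math. Ann. 245 (1979),
  §1 (1.3)–(1.4).
* [SerreLinearRepresentations1977] J.-P. Serre, Linear Representations of Finite Groups, §2.6 Thm. 8.
-/

noncomputable section

open CategoryTheory AlgebraicGeometry
open Literature.AlgebraicGeometry.Motives Literature.AlgebraicTopology.SingularHomology

namespace Literature.AlgebraicGeometry.HodgeTheory

variable {m : ℕ}

/-- **`π_α x = 0` for a non-zero character `α` with a zero coordinate**, in the middle cohomology of
the even-dimensional Fermat variety `X²ʳₘ` (`r, m ≥ 1`): `π_α x ∈ V(α) = 0`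
(`fermatEigenspace_eq_bot_of_apply_eq_zero`). [cite: Shioda1979HodgeFermat, §1 (1.3)–(1.4)]
[cite: Ran1980, §1 Prop. 1.7 (i)] -/
theorem fermatProjector_eq_zero_of_apply_eq_zero [NeZero m] {r : ℕ} (hr : 1 ≤ r)
    {α : Fin (2 * r + 2) → ZMod m} (hα : α ≠ 0) {i : Fin (2 * r + 2)} (hi : α i = 0)
    (x : complexBetti (fermatHypersurface (2 * r) m) (2 * r)) :
    fermatProjector m α (2 * r) x = 0 := by
  have h := fermatProjector_mem α x
  rw [fermatEigenspace_eq_bot_of_apply_eq_zero NeZero.one_le hr hα hi, Submodule.mem_bot] at h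
  exact h

/-- **`Σ_a χ_α(a)⁻¹ • g_a^* x = 0`** for a non-zero character `α` with a zero coordinate (middle
degree of `X²ʳₘ`, `r, m ≥ 1`): `|G| π_α x = Σ_a χ_α(a)⁻¹ g_a^* x` and `π_α x = 0`.
[cite: Shioda1979HodgeFermat, §1 (1.3)–(1.4)] [cite: SerreLinearRepresentations1977, §2.6 Thm. 8] -/
theorem sum_inv_fermatCharacter_smul_map_diagonalMap_eq_zero [NeZero m] {r : ℕ} (hr : 1 ≤ r)
    {α : Fin (2 * r + 2) → ZMod m} (hα : α ≠ 0) {i : Fin (2 * r + 2)} (hi : α i = 0)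
    (x : complexBetti (fermatHypersurface (2 * r) m) (2 * r)) :
    ∑ a : fermatGroup (2 * r) m, ((fermatCharacter m α a : ℂˣ) : ℂ)⁻¹ •
      singularCohomology.map ℂ ℂ
        (diagonalMap (fermatPolynomial ℂ (2 * r) m) (fermatGroup_le_diagonalStabilizer m a.2)) (2 * r) x = 0 := by
  have h := fermatProjector_eq_zero_of_apply_eq_zero hr hα hi x
  rw [eigenProjector_apply] at h
  exact (smul_eq_zero.mp h).resolve_left (inv_ne_zero (Nat.cast_ne_zero.mpr Fintype.card_ne_zero))

/-- **`π_δ x ≠ 0` from the OFF-stabiliser restriction numbers alone.** Let `δ` be a character of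
`X²ʳₘ` (`r, m ≥ 1`) with `δ_{i₀} ≠ 0`, `δ_{i₀} + δ_{i₁} = 0` (`i₀ ≠ i₁`), and `δ' ≠ 0` agree with
`δ` off `i₀, i₁` and vanish there. Let `x ∈ H²ʳ(X²ʳₘ(ℂ); ℂ)` satisfy `g_a^* x = χ_{δ'}(a) x` for
every `a` in the stabiliser `a_{i₀} = a_{i₁}`, and let a `ℂ`-linear `Λ` take the other translates to
`Λ(g_a^* x) = χ_{δ'}(a) t • A` (`a_{i₀} ≠ a_{i₁}`) with `t ≠ 0`, `A ≠ 0`. Then `π_δ x ≠ 0`.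
Proof: `Σ_a χ_{δ'}(a)⁻¹ g_a^* x = 0` (`δ'` has a zero coordinate), whence, applying `Λ`,
`N Λ(x) + N' t • A = 0` with `N = #{a | a_{i₀} = a_{i₁}} > 0`, `N' = |G| - N`; so the functional
`N • Λ` takes the values `χ_{δ'}(a) (N t) • A` off the stabiliser and `χ_{δ'}(a) (-N' t) • A` on it,
and `-N' t ≠ N t` because `(N + N') t = |G| t ≠ 0`: `fermatProjector_ne_zero_of_twisted_restrictions`
applies. For the cones of Aoki's Thm. 1-4 (i), `r = 0` case, this is the statement that the
self-intersection number of a cone is determined by the transversal ones through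
`Σ_ε C_ε ∼ 0` on primitive classes (Ran's eigenvalue `-m`).
[cite: Aoki1987, Thm. 1-4 (i) p. 388 and p. 386] [cite: Ran1980, §1 Prop. 1.14]
[cite: Shioda1979HodgeFermat, §1 (1.3)–(1.4)] [cite: SerreLinearRepresentations1977, §2.6 Thm. 8] -/
theorem fermatProjector_ne_zero_of_offStabilizer_restrictions [NeZero m] {r : ℕ} (hr : 1 ≤ r)
    (δ δ' : Fin (2 * r + 2) → ZMod m) {i₀ i₁ : Fin (2 * r + 2)} (h01 : i₀ ≠ i₁) (hδ : δ i₀ ≠ 0)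
    (hsum : δ i₀ + δ i₁ = 0) (hδ'₀ : δ' i₀ = 0) (hδ'₁ : δ' i₁ = 0)
    (hδ' : ∀ j, j ≠ i₀ → j ≠ i₁ → δ' j = δ j) (hδ'ne : δ' ≠ 0)
    (x : complexBetti (fermatHypersurface (2 * r) m) (2 * r))
    {V : Type*} [AddCommGroup V] [Module ℂ V]
    (Λ : complexBetti (fermatHypersurface (2 * r) m) (2 * r) →ₗ[ℂ] V)
    {A : V} (hA : A ≠ 0) {t : ℂ} (ht : t ≠ 0)
    (hstab : ∀ a : fermatGroup (2 * r) m,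
      (a : Fin (2 * r + 2) → ℂˣ) i₀ = (a : Fin (2 * r + 2) → ℂˣ) i₁ →
      singularCohomology.map ℂ ℂ
          (diagonalMap (fermatPolynomial ℂ (2 * r) m) (fermatGroup_le_diagonalStabilizer m a.2)) (2 * r) x =
        ((fermatCharacter m δ' a : ℂˣ) : ℂ) • x)
    (hoff : ∀ a : fermatGroup (2 * r) m,
      (a : Fin (2 * r + 2) → ℂˣ) i₀ ≠ (a : Fin (2 * r + 2) → ℂˣ) i₁ →
      Λ (singularCohomology.map ℂ ℂ
          (diagonalMap (fermatPolynomial ℂ (2 * r) m) (fermatGroup_le_diagonalStabilizer m a.2)) (2 * r) x) =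
        (((fermatCharacter m δ' a : ℂˣ) : ℂ) * t) • A) :
    fermatProjector m δ (2 * r) x ≠ 0 := by
  classical
  -- the stabiliser predicate and the two counts
  let P : fermatGroup (2 * r) m → Prop := fun a ↦
    (a : Fin (2 * r + 2) → ℂˣ) i₀ = (a : Fin (2 * r + 2) → ℂˣ) i₁
  set N : ℕ := (Finset.univ.filter fun a : fermatGroup (2 * r) m ↦ P a).card with hN
  set N' : ℕ := (Finset.univ.filter fun a : fermatGroup (2 * r) m ↦ ¬ P a).card with hN'
  have hNpos : 0 < N := by
    rw [hN, Finset.card_pos]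
    exact ⟨1, Finset.mem_filter.mpr ⟨Finset.mem_univ _, rfl⟩⟩
  have hNN' : N + N' = Fintype.card (fermatGroup (2 * r) m) := by
    rw [hN, hN']
    exact Finset.card_filter_add_card_filter_not _
  -- `Σ_a χ_{δ'}(a)⁻¹ g_a^* x = 0`
  have h0 := sum_inv_fermatCharacter_smul_map_diagonalMap_eq_zero hr hδ'ne hδ'₀ x
  -- apply `Λ` and split along the stabiliser
  have hterm : ∀ a : fermatGroup (2 * r) m,
      Λ (((fermatCharacter m δ' a : ℂˣ) : ℂ)⁻¹ • singularCohomology.map ℂ ℂ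
        (diagonalMap (fermatPolynomial ℂ (2 * r) m) (fermatGroup_le_diagonalStabilizer m a.2)) (2 * r) x) =
      if P a then Λ x else t • A := by
    intro a
    have hu : ((fermatCharacter m δ' a : ℂˣ) : ℂ) ≠ 0 := Units.ne_zero _
    by_cases ha : P a
    · rw [if_pos ha, hstab a ha, smul_smul, inv_mul_cancel₀ hu, one_smul]
    · rw [if_neg ha, map_smul, hoff a ha, smul_smul, ← mul_assoc, inv_mul_cancel₀ hu, one_mul]
  have h1 := congrArg Λ h0
  rw [map_sum, map_zero] at h1
  simp_rw [hterm] at h1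
  rw [Finset.sum_ite, Finset.sum_const, Finset.sum_const, ← hN, ← hN'] at h1
  -- `h1 : N • Λ x + N' • (t • A) = 0`
  have hΛx : ((N : ℂ) • Λ) x = (-((N' : ℂ) * t)) • A := by
    rw [LinearMap.smul_apply, neg_smul, eq_neg_iff_add_eq_zero, mul_smul, Nat.cast_smul_eq_nsmul,
      Nat.cast_smul_eq_nsmul]
    exact h1
  -- the criterion with `Λ' = N • Λ`, `s = -N' t`, `t' = N t`
  refine fermatProjector_ne_zero_of_twisted_restrictions δ δ' h01 hδ hsum hδ'₀ hδ'₁ hδ' x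
    ((N : ℂ) • Λ) hA (s := -((N' : ℂ) * t)) (t := (N : ℂ) * t) ?_ fun a ↦ ?_
  · intro hst
    have hG : ((N : ℂ) + N') * t = 0 := by linear_combination -hst
    have hG' : ((N : ℂ) + N') ≠ 0 := by
      rw [← Nat.cast_add, hNN', Nat.cast_ne_zero]
      exact Fintype.card_ne_zero
    exact ht ((mul_eq_zero.mp hG).resolve_left hG')
  · by_cases ha : P a
    · rw [if_pos ha, hstab a ha, map_smul, hΛx, smul_smul]
    · rw [if_neg ha, LinearMap.smul_apply, hoff a ha, smul_smul]
      congr 1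
      ring

end Literature.AlgebraicGeometry.HodgeTheory

end
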